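import Mathlib
import HarnessLib
import HarnessLib.Audit
import Summits.HodgeConjecture.HodgeConjecture.Theses.KleimanBFSeeds
import Summits.HodgeConjecture.HodgeConjecture.Theses.DoublyPolarisedTransport
import Summits.HodgeConjecture.HodgeConjecture.Theorems.DoublyPolarisedSimilarAnchorsOfTwistedCube
import Summits.HodgeConjecture.HodgeConjecture.Theorems.KleimanBFSeedsWeilSimilarTrans
import Summits.HodgeConjecture.HodgeConjecture.Theorems.KleimanBFSeedsKleimanSemiregularAnchorReductions
import Summits.HodgeConjecture.HodgeConjecture.Theorems.Ring2AbelianAllWeilSimilarDiscriminant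
import Literature.AlgebraicGeometry.Motives.WeilSimilar
import Literature.AlgebraicGeometry.HodgeTheory.WeilClassesBFSheafSeedAt

/-!
# Skeleton `Lines/chosen-anchor` for crux `KleimanSemiregularAnchor` (stmt-HodgeConjecture-25931)

HONEST FRAMING: a crux PROOF SKELETON (cruxes-workfile class), not a proof. It contains exactly one
`sorry`, inside the declared stub `stub_good`, which is the mathematical core of the crux (an open
deformation-theoretic existence statement); nothing here proves K2, rung H2, HC_AV, HC_CM or HC.

v3 (unit `leafhand-hodge-kleimanbfseeds-1-g0`, 2026-08-30, RESHAPE of the single stub, same line, same idea «choose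
ONE good anchor per similitude class»): the registered stub `stub_good` now has the signature
`GoodAnchorPerDiscriminantClass` — for every `C`, `d ≥ 1` and every norm-residue class `δ ∈ ℚˣ/Nm(K_dˣ)` of sign
`(-1)³` other than the split class, SOME `(3, d)` anchor `(P, ψ₀, e, e', a, a', w)` whose class `h(e, a)` carries a
non-degenerate discriminant witness of class `δ` (and `h(e', a')` hyperbolic, `w` a non-zero rational `(3,3)` Weil
class) at which `HasWeilClassDesignAt C 3 P h(e,a) w → HasBFSheafSeedAt C 3 P h(e,a) w`. The v2 signature
`GoodAnchorInClass` (kept below as a definition, no longer the stub) asked in addition for the Weil-similarity to a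
GIVEN anchor and the non-hyperbolicity of `h(e, a)`; both are THEOREMS of the tree once the discriminant class is
fixed (Landherr / van Geemen 5.2–5.4: `isWeilSimilar_of_hasWeilDiscriminantNondeg`,
`not_isHyperbolicWeilType_of_hasWeilDiscriminantNondeg_ne`), and the composition is now the LANDED theorem
`Theorems.kleimanSemiregularAnchor_of_goodAnchor_in_each_discriminantClass` (p793968, file
`Theorems/KleimanBFSeedsKleimanSemiregularAnchorReductions.lean`, which also proves: one model suffices for both
predicates, `upgrade_iff_on_self`; K2 ⇐ the upgrade on the twisted CM cubes `E₀³ × E₀³`, X2's anchors, which realise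
every such `δ`). So the prover of `stub_good` exhibits, per `(C, d, δ)`, ONE anchor of class `δ` (e.g. a twisted CM
cube with a weight-`m` Segre class, `δ = [-m]`, `exists_hasWeilDiscriminantNondeg_twistedSquare`) and ONE
`I ∋ 3`-semiregular finite locally free sheaf ON IT (`upgrade_iff_on_self`) — nothing about frames or similarity.

Provenance. This is the lead prover's RE-PUBLICATION (unit `leafhand-hodge-kleimanbf-1-g0`,
2026-08-30) of the planner's registered skeleton `Lines/chosen-anchor` (hodge-idea-1 g5, sha16
0a8d3faf658559d6, stubs `stub_good` / `stub_trans` / `stub_supply`), whose file lives in a planner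
session folder and in the gate evidence store, neither of which is mounted in a prover jail (and
`ledger crux ls` shows no workfile): the statements below are reconstructed from the line card
(ideators/hodge-idea-1 INBOX l.58; tribunal mk_r1.py l.39: «stub_good (load-bearing: in the
Weil-similitude class of every doubly-polarised anchor SOME doubly-polarised anchor upgrades class
designs to BF sheaf seeds) · stub_trans (= support item 26054 WeilSimilarTrans, linear algebra) ·
stub_supply (= X2 DoublyPolarisedSimilarAnchors, PROVED p602146)»), with the SAME stub names.

RESHAPE (L4 of the line protocol): two of the three stubs are now DISCHARGED BY NAME in this file —
* `stub_supply : AnchorSupply` with `AnchorSupply := Theses.DoublyPolarisedTransport.DoublyPolarisedSimilarAnchors`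
  (X2), closed by the landed theorem `doublyPolarisedSimilarAnchors_holds` (p602146);
* `stub_trans : SimilarTrans` with `SimilarTrans := Theses.KleimanBFSeeds.WeilSimilarTrans`
  (support item stmt-HodgeConjecture-26054), closed by the landed theorem
  `Theorems.weilSimilarTrans_proof` (file `Theorems/KleimanBFSeedsWeilSimilarTrans.lean`);
so the registered stub list shrinks to `stub_good : GoodAnchorInClass` — the ∃-core of K2: in the
Weil-similitude class of every doubly-polarised `(3, d)` anchor `(P, ψ₀, h(e,a) non-hyperbolic,
h(e',a') hyperbolic, w)` there is SOME doubly-polarised anchor `(P', ψ₀', …, w')`, Weil-similar to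
it at the non-hyperbolic classes, at which every class-level design upgrades to a Buchweitz–Flenner
sheaf seed (`HasWeilClassDesignAt C 3 P' h' w' → HasBFSheafSeedAt C 3 P' h' w'`).

Composition `KleimanSemiregularAnchor_of` (kernel-checked, sorry-free given the stubs): for a
non-hyperbolic member `(A, φ)` with a non-zero Hodge Weil class, X2 (`stub_supply`) gives a
doubly-polarised anchor `P` Weil-similar to `(A, φ, h(e_A, a_A))`; `stub_good` gives a good anchor
`P'` Weil-similar to `P` (at the non-hyperbolic classes); `stub_trans` (transitivity through `P`,
`dim P = 6 = 2·3`) makes `P'` Weil-similar to `A`; the conclusion of the crux is read off.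
-/

-- every declaration of this problem lives in `Summit.HodgeConjecture.HodgeConjecture.…` (summit = sub-problem)
set_option linter.dupNamespace false

noncomputable section

open CategoryTheory
open Literature.AlgebraicGeometry.Motives
open Literature.AlgebraicGeometry.HodgeTheory
open Literature.AlgebraicGeometry.VanGeemen1994
open Summit.HodgeConjecture.HodgeConjecture.Ring2.AbelianAll

namespace Summit.HodgeConjecture.HodgeConjecture.Cruxes.KleimanSemiregularAnchor.ChosenAnchor

/-- The `K`-symmetrised polarisation class `h(e, a) = d·e^*a + ψ₀^*(e^*a) ∈ H²(P(ℂ); ℂ)` of a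
projective embedding `e` and an ambient class `a` (the `+d`-eigenprojection of `e^*a` under `ψ₀^*`),
exactly the expression used verbatim in the route file. -/
def hClass (P : AbelianVariety ℂ) (ψ₀ : P ⟶ P) (d : ℕ) (e : ProjectiveEmbedding P.X)
    (a : complexBetti (projectiveSpace e.n ℂ) 2) : complexBetti P.X 2 :=
  (d : ℂ) • complexBetti.map e.ι 2 a + complexBetti.map ψ₀.hom.hom.hom 2 (complexBetti.map e.ι 2 a)

/-- **Doubly-polarised `(3, d)` anchor data** at `(P, ψ₀, e, e', a, a', w)`: `dim P = 6`,
`ψ₀ ≫ ψ₀ = -d`, `a`, `a'` rational non-zero ambient classes, `w ∈ weilClassesOf P ψ₀ 3 d` rational,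
non-zero, of Hodge type `(3,3)`, `P` HYPERBOLIC at `h(e', a')` and NON-hyperbolic at `h(e, a)` —
the twelve anchor conjuncts of the crux `KleimanSemiregularAnchor`, in its order. -/
def IsDoublyPolarisedAnchor (d : ℕ) (P : AbelianVariety ℂ) (ψ₀ : P ⟶ P)
    (e e' : ProjectiveEmbedding P.X) (a : complexBetti (projectiveSpace e.n ℂ) 2)
    (a' : complexBetti (projectiveSpace e'.n ℂ) 2) (w : complexBetti P.X (2 * 3)) : Prop :=
  P.dim = 2 * 3 ∧ ψ₀ ≫ ψ₀ = -(d • 𝟙 P) ∧ IsRationalClass a ∧ a ≠ 0 ∧ IsRationalClass a' ∧ a' ≠ 0 ∧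
    w ∈ weilClassesOf P ψ₀ 3 d ∧ IsRationalClass w ∧ w ≠ 0 ∧ IsOfHodgeType (2 * 3) P.X (2 * 3) 3 3 w ∧
    IsHyperbolicWeilType P ψ₀ 3 (hClass P ψ₀ d e' a') ∧ ¬ IsHyperbolicWeilType P ψ₀ 3 (hClass P ψ₀ d e a)

/-- **v2 stub statement `GoodAnchorInClass`** (superseded as the registered signature of `stub_good` by
`GoodAnchorPerDiscriminantClass` below; kept for the record — the ∃-core of K2 in its Weil-similarity form): for every Chern
character `C` on Betti cohomology, every `d > 0` and every doubly-polarised `(3, d)` anchor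
`(P, ψ₀, e, e', a, a', w)` there is SOME doubly-polarised `(3, d)` anchor `(P', ψ₀', f, f', b, b', w')`
which is Weil-similar to `(P, ψ₀)` at the non-hyperbolic classes `h(f, b)`, `h(e, a)` and AT WHICH
every class-level design upgrades to a Buchweitz–Flenner sheaf seed:
`HasWeilClassDesignAt C 3 P' h(f,b) w' → HasBFSheafSeedAt C 3 P' h(f,b) w'`. -/
def GoodAnchorInClass : Prop :=
  ∀ (C : ChernCharacterBetti) (d : ℕ), 0 < d → ∀ (P : AbelianVariety ℂ) (ψ₀ : P ⟶ P)
    (e e' : ProjectiveEmbedding P.X) (a : complexBetti (projectiveSpace e.n ℂ) 2)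
    (a' : complexBetti (projectiveSpace e'.n ℂ) 2) (w : complexBetti P.X (2 * 3)),
    IsDoublyPolarisedAnchor d P ψ₀ e e' a a' w →
    ∃ (P' : AbelianVariety ℂ) (ψ₀' : P' ⟶ P') (f f' : ProjectiveEmbedding P'.X)
      (b : complexBetti (projectiveSpace f.n ℂ) 2) (b' : complexBetti (projectiveSpace f'.n ℂ) 2)
      (w' : complexBetti P'.X (2 * 3)),
      IsDoublyPolarisedAnchor d P' ψ₀' f f' b b' w' ∧
      (HasWeilClassDesignAt C 3 P' (hClass P' ψ₀' d f b) w' → HasBFSheafSeedAt C 3 P' (hClass P' ψ₀' d f b) w') ∧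
      IsWeilSimilar 3 P' ψ₀' (hClass P' ψ₀' d f b) P ψ₀ (hClass P ψ₀ d e a)

/-- **Stub statement `SimilarTrans`** = the route's support item `WeilSimilarTrans`
(stmt-HodgeConjecture-26054): Weil-similarity is transitive through a middle object of dimension `2n`. -/
def SimilarTrans : Prop :=
  Summit.HodgeConjecture.HodgeConjecture.Theses.KleimanBFSeeds.WeilSimilarTrans

/-- **Stub statement `AnchorSupply`** = X2 `DoublyPolarisedSimilarAnchors` of route
`DoublyPolarisedTransport` (stmt-HodgeConjecture-23603, PROVED p602146), by name. -/
def AnchorSupply : Prop :=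
  Summit.HodgeConjecture.HodgeConjecture.Theses.DoublyPolarisedTransport.DoublyPolarisedSimilarAnchors

/-- **Stub statement `GoodAnchorPerDiscriminantClass`** (v3, the registered signature of `stub_good`; the
∃-core of K2 with the Landherr bookkeeping discharged): for every Chern character `C`, every `d ≥ 1` and every
norm-residue class `δ ∈ ℚˣ/Nm(ℚ(√-d)ˣ)` of sign `(-1)³` different from the split class `[(-1)³]`, there is a
`(3, d)` anchor `(P, ψ₀, e, e', a, a', w)` — `dim P = 6`, `ψ₀² = -d`, `a`, `a'` rational `≠ 0`, `w` a non-zero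
rational `(3,3)` Weil class, `ψ₀` hyperbolic at `h(e', a')`, `h(e, a)` with a non-degenerate discriminant witness of
class `δ` — at which every class-level design upgrades to a Buchweitz–Flenner sheaf seed. This is VERBATIM the
hypothesis of the landed theorem `Theorems.kleimanSemiregularAnchor_of_goodAnchor_in_each_discriminantClass`. -/
def GoodAnchorPerDiscriminantClass : Prop :=
  ∀ (C : ChernCharacterBetti) (d : ℕ) (δ : Literature.AlgebraicGeometry.VanGeemen1994.weilNormResidueGroup d), 0 < d →
    Summit.HodgeConjecture.HodgeConjecture.Ring2.AbelianAll.weilSign d δ = (-1) ^ 3 →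
    δ ≠ QuotientGroup.mk ((-1 : ℚˣ) ^ 3) →
    ∃ (P : AbelianVariety ℂ) (ψ₀ : P ⟶ P) (e e' : ProjectiveEmbedding P.X)
      (a : complexBetti (projectiveSpace e.n ℂ) 2) (a' : complexBetti (projectiveSpace e'.n ℂ) 2)
      (w : complexBetti P.X (2 * 3)),
      P.dim = 2 * 3 ∧ ψ₀ ≫ ψ₀ = -(d • 𝟙 P) ∧ IsRationalClass a ∧ a ≠ 0 ∧ IsRationalClass a' ∧ a' ≠ 0 ∧
      w ∈ weilClassesOf P ψ₀ 3 d ∧ IsRationalClass w ∧ w ≠ 0 ∧ IsOfHodgeType (2 * 3) P.X (2 * 3) 3 3 w ∧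
      IsHyperbolicWeilType P ψ₀ 3
        ((d : ℂ) • complexBetti.map e'.ι 2 a' + complexBetti.map ψ₀.hom.hom.hom 2 (complexBetti.map e'.ι 2 a')) ∧
      Literature.AlgebraicGeometry.VanGeemen1994.HasWeilDiscriminantNondeg P ψ₀ 3 d
        ((d : ℂ) • complexBetti.map e.ι 2 a + complexBetti.map ψ₀.hom.hom.hom 2 (complexBetti.map e.ι 2 a)) δ ∧
      (HasWeilClassDesignAt C 3 P
          ((d : ℂ) • complexBetti.map e.ι 2 a + complexBetti.map ψ₀.hom.hom.hom 2 (complexBetti.map e.ι 2 a)) w →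
        HasBFSheafSeedAt C 3 P
          ((d : ℂ) • complexBetti.map e.ι 2 a + complexBetti.map ψ₀.hom.hom.hom 2 (complexBetti.map e.ι 2 a)) w)

/-- **The reshape is lossless, direction v3 ⟹ v2** (sorry-free): one good anchor per discriminant class gives a
good anchor Weil-similar to any given doubly-polarised anchor `P` — the class `δ` of `h(e, a)` on `P` is not split
(else `h(e, a)` would be hyperbolic, `isHyperbolicWeilType_of_hasWeilDiscriminantNondeg_split`), the good anchor of
class `δ` is not hyperbolic at its class and is Weil-similar to `P` (Landherr). [cite: vanGeemen1994HodgeAV, Lemma 5.2 (3)–(4), 5.4 (5.4.1)] -/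
theorem goodAnchorInClass_of_perClass (h : GoodAnchorPerDiscriminantClass) : GoodAnchorInClass := by
  intro C d hd P ψ₀ e e' a a' w hanch
  obtain ⟨hP, hψ, ha, ha0, ha', ha'0, hwW, hwrat, hw0, hwH, hhyp, hnhyp⟩ := hanch
  have n3 : (0 : ℕ) < 3 := by norm_num
  have hW : IsWeilType P ψ₀ 3 d := isWeilType_of_weilClass_ne_zero n3 hd hP hψ hwW hw0 hwH
  obtain ⟨δ, hδ, hsign⟩ := exists_hasWeilDiscriminantNondeg_weilSign hW e ha ha0
  have hne : δ ≠ QuotientGroup.mk ((-1 : ℚˣ) ^ 3) := by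
    rintro rfl
    exact hnhyp (isHyperbolicWeilType_of_hasWeilDiscriminantNondeg_split n3 hP hd hψ e ha ha0
      ⟨w, hwW, hwrat, hwH, hw0⟩ hδ)
  obtain ⟨P', ψ₀', f, f', b, b', w', hP', hψ', hb, hb0, hb', hb'0, hw'W, hw'rat, hw'0, hw'H, hhyp', hN', hup'⟩ :=
    h C d δ hd hsign hne
  have hW' : IsWeilType P' ψ₀' 3 d := isWeilType_of_weilClass_ne_zero n3 hd hP' hψ' hw'W hw'0 hw'H
  have hnot' := not_isHyperbolicWeilType_of_hasWeilDiscriminantNondeg_ne n3 hP' hd hψ' f hb hb0 hN' hne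
  have hsim := isWeilSimilar_of_hasWeilDiscriminantNondeg hW' hW f hb hb0 e ha ha0 hN' hδ
  exact ⟨P', ψ₀', f, f', b, b', w', ⟨hP', hψ', hb, hb0, hb', hb'0, hw'W, hw'rat, hw'0, hw'H, hhyp', hnot'⟩,
    hup', hsim⟩

/-- **The reshape is lossless, direction v2 ⟹ v3** (sorry-free): given a class `δ` of sign `(-1)³`, not split,
X2's twisted CM cube `E₀³ × E₀³` with a weight-`m` Segre class REALISES `δ = [-m]` as a doubly-polarised anchor
(verbatim the construction of `doublyPolarisedSimilarAnchors_holds`); a good anchor Weil-similar to it (v2) has the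
same discriminant class (`hasWeilDiscriminantNondeg_of_isWeilSimilar`, van Geemen 5.2 (3)), hence is a good anchor of
class `δ`. [cite: vanGeemen1994HodgeAV, 4.14, Lemma 5.2 (3)–(4), 5.3–5.4] [cite: Landherr1936HermitianForms] -/
theorem goodAnchorPerDiscriminantClass_of_inClass (h : GoodAnchorInClass) : GoodAnchorPerDiscriminantClass := by
  intro C d δ hd hsign hne
  have n3 : (0 : ℕ) < 3 := by norm_num
  -- `δ = [-m]` for a positive integer `m`
  obtain ⟨q, rfl⟩ := QuotientGroup.mk_surjective δ
  have hq : (q : ℚ) < 0 := by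
    rw [weilSign_mk] at hsign
    have h3 : ((-1 : ℤˣ) ^ 3) = -1 := Odd.neg_one_pow ⟨1, by norm_num⟩
    exact (ratSign_eq_neg_one_iff q).1 (hsign.trans h3)
  obtain ⟨m, hm, hmq⟩ := exists_nat_mk_neg_eq (d := d) q hq
  -- the twisted CM cube `T × T`, `T = E₀³`, `E₀ = ℂ/(ℤ + ℤ√-d)`
  obtain ⟨E₀, χ₀, hE, hχ⟩ := Literature.NumberTheory.EllipticCurves.CMEndomorphism.exists_cmCurve_sqrt_neg d hd
  obtain ⟨φT, hφT⟩ := exists_sq_eq_neg_powSucc χ₀ hχ 2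
  have hT : (E₀.powSucc 2).dim = 2 + 1 := by rw [dim_powSucc', hE, mul_one]
  have hPdim : ((E₀.powSucc 2).prod (E₀.powSucc 2)).dim = 2 * 3 := dim_twistedSquare hT
  have hΦ := twistedSquare_comp_self hφT
  have hWP : IsWeilType ((E₀.powSucc 2).prod (E₀.powSucc 2))
      (AbelianVariety.prodLift (AbelianVariety.fst (E₀.powSucc 2) (E₀.powSucc 2) ≫ φT)
        (AbelianVariety.snd (E₀.powSucc 2) (E₀.powSucc 2) ≫ (-φT))) 3 d :=
    isWeilType_twistedSquare n3 hT hd hφT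
  obtain ⟨eT, aT, haT, haT0, hfam⟩ :=
    exists_hasWeilDiscriminantNondeg_twistedSquare (m₀ := 2) (by norm_num) hT hd hφT
  -- weight `1`: split class, a hyperbolic `h'`
  obtain ⟨e₁, a₁, w₁, ha₁, ha₁0, hw₁, -, hN₁⟩ := hfam 1 one_pos
  have hw₁' : w₁ = (-1 : ℚˣ) ^ 3 := by
    ext
    rw [hw₁]
    push_cast
    norm_num
  rw [hw₁'] at hN₁
  obtain ⟨-, e', a', ha', ha'0, hhyp⟩ :=
    Literature.AlgebraicGeometry.VanGeemen1994.IsWeilType.isSplitWeilType_of_hasWeilDiscriminantNondeg_split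
      hWP e₁ ha₁ ha₁0 hN₁
  -- weight `m`: class `[(-m)³] = [-m] = δ`
  obtain ⟨e, a, w, ha, ha0, hw, -, hN⟩ := hfam m hm
  have hwm : w = (-Units.mk0 (m : ℚ) (Nat.cast_ne_zero.2 hm.ne')) ^ (2 * 1 + 1) := by
    ext
    rw [hw]
    simp only [Units.val_pow_eq_pow_val, Units.val_neg, Units.val_mk0]
  have hwδ : (QuotientGroup.mk w : weilNormResidueGroup d) = QuotientGroup.mk q := by
    rw [hwm, weilNormResidueGroup_mk_pow_odd, hmq]
  rw [hwδ] at hN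
  have hnot := not_isHyperbolicWeilType_of_hasWeilDiscriminantNondeg_ne n3 hPdim hd hΦ e ha ha0 hN hne
  obtain ⟨w₀, hw₀, hw₀0, hw₀Q⟩ := exists_isRationalClass_ne_zero_mem_weilClassesOf n3 hPdim hd hΦ
  have hw₀H := hWP.isOfHodgeType_of_mem_weilClassesOf hw₀
  -- v2 at the cube anchor: a good anchor `P'` Weil-similar to it, hence of the same class `δ`
  obtain ⟨P', ψ₀', f, f', b, b', w', ⟨hP', hψ', hb, hb0, hb', hb'0, hw'W, hw'rat, hw'0, hw'H, hhyp', -⟩,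
    hup', hsim'⟩ :=
    h C d hd _ _ e e' a a' w₀ ⟨hPdim, hΦ, ha, ha0, ha', ha'0, hw₀, hw₀Q, hw₀0, hw₀H, hhyp, hnot⟩
  have hN' := hasWeilDiscriminantNondeg_of_isWeilSimilar n3 hPdim hP' hsim'.symm hN
  exact ⟨P', ψ₀', f, f', b, b', w', hP', hψ', hb, hb0, hb', hb'0, hw'W, hw'rat, hw'0, hw'H, hhyp', hN', hup'⟩

/-- **v2 ⟺ v3**: the two signatures of `stub_good` are equivalent (sorry-free, tree theorems only).
[cite: vanGeemen1994HodgeAV, Lemma 5.2 (3)–(4)] -/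
theorem goodAnchorPerDiscriminantClass_iff : GoodAnchorPerDiscriminantClass ↔ GoodAnchorInClass :=
  ⟨goodAnchorInClass_of_perClass, goodAnchorPerDiscriminantClass_of_inClass⟩

/-- STUB (open, load-bearing; v3 signature): the ∃-core of K2 — one good anchor per discriminant class. -/
theorem stub_good : GoodAnchorPerDiscriminantClass := by
  sorry

/-- Former stub `stub_trans`, DISCHARGED by name: `Theorems.weilSimilarTrans_proof`
(`Theorems/KleimanBFSeedsWeilSimilarTrans.lean`). -/
theorem stub_trans : SimilarTrans :=
  Summit.HodgeConjecture.HodgeConjecture.Theorems.weilSimilarTrans_proof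

/-- Former stub `stub_supply`, DISCHARGED by name: X2 `doublyPolarisedSimilarAnchors_holds` (p602146). -/
theorem stub_supply : AnchorSupply :=
  Summit.HodgeConjecture.HodgeConjecture.Theses.DoublyPolarisedTransport.doublyPolarisedSimilarAnchors_holds

/-- **Composition** (v3): the stub gives the crux `KleimanSemiregularAnchor` BY NAME. This is, verbatim, the proof of
the landed theorem `Theorems.kleimanSemiregularAnchor_of_goodAnchor_in_each_discriminantClass` (p793968, file
`Theorems/KleimanBFSeedsKleimanSemiregularAnchorReductions.lean` §4) applied to `stub_good` — inlined here so that the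
skeleton elaborates on farm nodes whose build of that module predates §4; the two are interchangeable
(`KleimanSemiregularAnchor_of = Theorems.kleimanSemiregularAnchor_of_goodAnchor_in_each_discriminantClass stub_good`).
The member's discriminant class `δ` is of sign `(-1)³` and not split; the good anchor of class `δ` is not hyperbolic at
`h(e, a)` and is Weil-similar to the member by Landherr. This is the ONLY theorem of the file concluding the crux; its
`sorry`-cone is exactly `stub_good`. (The v2 composition through `stub_supply` = X2 and `stub_trans` = `WeilSimilarTrans`
is subsumed: X2's content is the existence of an anchor in each class, transitivity is replaced by Landherr.) -/
theorem KleimanSemiregularAnchor_of :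
    Summit.HodgeConjecture.HodgeConjecture.Theses.KleimanBFSeeds.KleimanSemiregularAnchor := by
  have hgood : GoodAnchorPerDiscriminantClass := stub_good
  intro C d hd A φ hA hφ hns hwA
  obtain ⟨wA, hwA, hwA0, hwAH⟩ := hwA
  have n3 : (0 : ℕ) < 3 := by norm_num
  -- `(A, φ)` is of Weil type `(3, d)`; an embedding; its discriminant class `δ` (sign `(-1)³`, not split)
  have hW' : IsWeilType A φ 3 d := isWeilType_of_weilClass_ne_zero n3 hd hA hφ hwA hwA0 hwAH
  obtain ⟨eA, aA, haA, haA0, -⟩ := exists_weightedSegreEmbedding_self_prod A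
  obtain ⟨δ, hδA, hsign⟩ := exists_hasWeilDiscriminantNondeg_weilSign hW' eA haA haA0
  have hne : δ ≠ QuotientGroup.mk ((-1 : ℚˣ) ^ 3) := by
    rintro rfl
    obtain ⟨-, e, a, ha, ha0, hh⟩ :=
      Literature.AlgebraicGeometry.VanGeemen1994.IsWeilType.isSplitWeilType_of_hasWeilDiscriminantNondeg_split
        hW' eA haA haA0 hδA
    exact hns e a ha ha0 hh
  -- the good anchor of class `δ`
  obtain ⟨P, ψ₀, e, e', a, a', w, hP, hψ, ha, ha0, ha', ha'0, hwW, hwrat, hw0, hwH, hhyp, hN, hup⟩ :=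
    hgood C d δ hd hsign hne
  have hWP : IsWeilType P ψ₀ 3 d := isWeilType_of_weilClass_ne_zero n3 hd hP hψ hwW hw0 hwH
  -- not hyperbolic at `h(e, a)` (class `δ ≠ [(-1)³]`), and Weil-similar to the member (Landherr)
  have hnot := not_isHyperbolicWeilType_of_hasWeilDiscriminantNondeg_ne n3 hP hd hψ e ha ha0 hN hne
  have hsim := isWeilSimilar_of_hasWeilDiscriminantNondeg hWP hW' e ha ha0 eA haA haA0 hN hδA
  exact ⟨eA, aA, P, ψ₀, e, e', a, a', w, haA, haA0, hP, hψ, ha, ha0, ha', ha'0, hwW, hwrat, hw0, hwH, hhyp,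
    hnot, hup, hsim⟩

end Summit.HodgeConjecture.HodgeConjecture.Cruxes.KleimanSemiregularAnchor.ChosenAnchor

end
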